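import Literature.Geometry.Riemannian.SphericalCylinderConformalMap
import Literature.Geometry.Riemannian.SphericalCylinderConformalKernel
import Literature.Geometry.Riemannian.SphericalCylinderEntropy
import Literature.Geometry.Riemannian.ColdingMinicozziEntropyInvariance
import Literature.Geometry.Riemannian.ColdingMinicozziEntropyAreaRatio
import Mathlib
import HarnessLib

/-!
# Small-scale conformal domination `F_{y,t}(Φ A) ≤ (1 + δ) λ_cyl(A)` below the conformal scale, modulo
# the Cheeger–Yau lower bound for the heat kernel of `S⁴`

Topic `Literature/Geometry/Riemannian`; third file of the series `SphericalCylinderConformalMap.lean`,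
`SphericalCylinderConformalKernel.lean` (the small-scale half of the "conformal kernel domination" between
the typed cylinder entropy `λ_cyl` of `SphericalCylinderEntropy.lean` on `N = S⁴ × ℝ ⊂ ℝ⁶` and the
Colding–Minicozzi Gaussian areas of `ColdingMinicozziEntropy.lean` on `ℝ⁵`, along the conformal map
`Φ(x, s) = eˢ x`; written for line `conformal-kernel-domination` of crux `CylinderEntropy.SliceIsolation`
of route `SmoothPoincare4/CylinderEntropy`, stub `stub_smallScaleDomination`, but stated on the fixed pair
of spaces `(N, ℝ⁵)` only).

THE STATEMENT: for every `δ > 0` there is `t₁ > 0` such that for every `t₀`, every measurable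
`A ⊆ N = {z ∈ ℝ⁶ | ∑_{i<5} zᵢ² = 1}` with `|z₅ - t₀| ≤ 1` on `A`, every centre `y ∈ ℝ⁵` and every scale
`0 < t ≤ t₁ e^{2t₀}`, `gaussianArea 4 y t (Φ '' A) ≤ ofReal (1 + δ) * cylEntropy A`, `Φ z = e^{z₅} z'`.

WHAT IS PROVED: `smallScaleDomination_of_cheegerYau (h : CheegerYauZonalSphereFour) : <that statement>`,
i.e. the statement MODULO one published fact, the NAMED FACT `CheegerYauZonalSphereFour` of this file
(Cheeger–Yau 1981 / Davies 1989 Thm 5.6.1 for `S⁴`, written on the typed Gegenbauer series `zonal` of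
`SphericalCylinderEntropy.lean`): a near-diagonal Gaussian LOWER bound for the `S⁴` heat kernel, which the
tree does not prove (it has the large-scale bound `one_sub_tail_le_zonal` only) and without which `λ_cyl`
of a small flat disc cannot be bounded below at all.

THE PROOF (`pointwise_domination` + the two companion files).  Given `δ` put `δ' = min δ 1`, `ε = δ'/40`,
`κ = 3ε`, `c₀ = δ'/4`, `C = log(e⁴/6c₀)`, `t₁ = (ε²/(16e²(C+4)))²`.  For `A, y, t` as above:
1. (Jacobian) `∫_{Φ A} g dμHE⁴ ≤ (1 + c₀) ∫_A e^{4z₅} g(Φ z) dμHE⁴` (layer cake + `Φ|_N` is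
   `e^M`-Lipschitz below height `M`; `SphericalCylinderConformalMap.lean`);
2. (pointwise) with `T = t e^{-2t₀} ≤ t₁`, `Λ = C - 2 log T`, the smallness `16e²TΛ ≤ ε²` holds, and for
   every `z ∈ N` of the slab `(4πt)⁻² e^{4z₅} e^{-‖Φz-y‖²/4t} ≤ c₁ V⁻¹ K_{p,σ}(z) + c₀ V⁻¹`, `V = 8π²/3`,
   `c₁ = e^{4ε}(1+κ)²`, for ONE centre `p ∈ N` and ONE scale `σ > 0` depending on `(y, t)` only: if
   `‖y‖ ≤ e^{t₀-1}/2` or `‖Φz - y‖² ≥ 4tΛ` the point only sees the area atom (`far_bound`); otherwise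
   `p = (y/‖y‖, log ‖y‖)`, `σ = (1+κ)t/‖y‖²`, the Euclidean defect is `≤ ε²` and `near_kernel_bound` + the
   Cheeger–Yau minorant of `V⁻¹ zonal` give the kernel term;
3. (integrate) `V⁻¹ ∫_A K_{p,σ} dμHE⁴ = F̂_{p,σ}(A) ≤ λ_cyl(A)` and `V⁻¹ μHE⁴(A) = μH⁴(A)/μH⁴(S⁴) ≤ λ_cyl(A)`
   (`measure_ratio_le_cylEntropy`, bounded height ⇐ slab), the common Haar factor of `μHE⁴ = c μH⁴` on
   `ℝ⁵` and `ℝ⁶` cancelling; total mass `(1 + c₀)(c₁ + c₀) ≤ 1 + δ' ≤ 1 + δ` (`constants`).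

## References
* J. Cheeger, S.-T. Yau, *A lower bound for the heat kernel*, Comm. Pure Appl. Math. 34 (1981) 465–480.
  [CheegerYau1981]
* E. B. Davies, *Heat kernels and spectral theory* (1989), Thm 5.6.1. [Davies1989]
* C. Efthimiou, C. Frye, *Spherical harmonics in p dimensions* (2014), Prop. 4.5, Thm 4.11, (4.39).
  [EfthimiouFrye2014]
* T. H. Colding, W. P. Minicozzi II, Ann. of Math. 175 (2012) 755–833. [ColdingMinicozzi2012]
-/

noncomputable section

open Set Function MeasureTheory MeasureTheory.Measure
open scoped ENNReal NNReal BigOperators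
open Literature.Geometry.Manifold.CylinderSlice
open Literature.Geometry.Riemannian.SphericalCylinderEntropy

namespace Literature.Geometry.Riemannian


/-! ### The named fact: Cheeger–Yau for `S⁴`, on the typed zonal series -/

/-- **Cheeger–Yau lower bound for the heat kernel of the round unit `4`-sphere, on the typed zonal
series.** For every `σ > 0` and `c ∈ [-1, 1]`,
`𝔥(σ, c) = ∑_k e^{-k(k+3)σ} (2k+3)/3 · C_k^{(3/2)}(c) ≥ (8π²/3) (4πσ)⁻² exp(-arccos(c)²/(4σ))`.
Here `𝔥 = zonal` (`Literature/Geometry/Riemannian/SphericalCylinderEntropy.lean`) is `vol(S⁴) = 8π²/3`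
times the heat kernel `K(σ, ξ, η)` of `S⁴` written through the eigenfunction expansion in spherical
harmonics (`Δ_{S⁴} Y_k = -k(k+3) Y_k`, Efthimiou–Frye Prop. 4.5; addition theorem
`∑_j Y_{k,j}(ξ) Y_{k,j}(η) = (N(5,k)/vol S⁴) P_k(⟨ξ,η⟩)` with `P_k = C_k^{(3/2)}/C_k^{(3/2)}(1)`,
`N(5,k)/C_k^{(3/2)}(1) = (2k+3)/3`, ibid. Thm 4.11 and (4.39)), evaluated at `c = ⟨ξ, η⟩ = cos d(ξ, η)`;
the inequality is the sharp Gaussian lower bound `K(t, x, y) ≥ (4πt)^{-n/2} e^{-d(x,y)²/4t}` for complete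
`n`-manifolds with `Ric ≥ 0` (Cheeger–Yau 1981; Davies, *Heat kernels and spectral theory*, Thm 5.6.1),
applied to `S⁴` (`n = 4`, `Ric = 3g ≥ 0`, `d = arccos c ∈ [0, π]`).
[cite: Davies1989, Thm 5.6.1] -/
def CheegerYauZonalSphereFour : Prop :=
  ∀ σ : ℝ, 0 < σ → ∀ c : ℝ, -1 ≤ c → c ≤ 1 →
    (8 * Real.pi ^ 2 / 3) * ((4 * Real.pi * σ) ^ 2)⁻¹ * Real.exp (-(Real.arccos c) ^ 2 / (4 * σ)) ≤
      Literature.Geometry.Riemannian.SphericalCylinderEntropy.zonal σ c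


namespace SphericalCylinderConformal

/-! ### Pointwise domination of the pulled-back Euclidean kernel -/

/-- **Pointwise domination.** Under the Cheeger–Yau bound, with the constants `ε, κ, c₀` and the
smallness `16e² T Λ ≤ ε²` (`T = t e^{-2t₀}`, `Λ = log(e⁴/6c₀) - 2 log T`), for every Euclidean centre
`y` there are ONE cylinder centre `p ∈ N` and ONE scale `σ > 0` such that at every point `z ∈ N` of the
unit slab around `t₀` the Jacobian-weighted Euclidean kernel `(4πt)⁻² e^{4 z₅} e^{-‖Φz - y‖²/4t}` is at
most `e^{4ε}(1+κ)² · V⁻¹ K_{p,σ}(z) + c₀ V⁻¹` (`V = 8π²/3`); centres with `‖y‖ ≤ e^{t₀-1}/2` and far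
points see only the area atom `c₀/V`, near points the broadened kernel at `p = (ŷ, log‖y‖)`,
`σ = (1+κ) t/‖y‖²`. [folklore] -/
theorem pointwise_domination (hCY : CheegerYauZonalSphereFour) {ε κ c₀ : ℝ} (hε : 0 < ε)
    (hε5 : ε ≤ 1 / 5) (hκ : 0 ≤ κ) (hκε : 1 ≤ (1 + κ) * (1 - ε) ^ 2) (hc₀ : 0 < c₀)
    {t t₀ : ℝ} (ht : 0 < t)
    (hsmall : 16 * Real.exp 2 * (t * Real.exp (-2 * t₀)) *
      (Real.log (Real.exp 4 / (6 * c₀)) - 2 * Real.log (t * Real.exp (-2 * t₀))) ≤ ε ^ 2)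
    (y : EuclideanSpace ℝ (Fin 5)) :
    ∃ p : EuclideanSpace ℝ (Fin 6), (∑ i : Fin 5, p (Fin.castSucc i) ^ 2 = 1) ∧ ∃ σ : ℝ, 0 < σ ∧
      ∀ z : EuclideanSpace ℝ (Fin 6), (∑ i : Fin 5, z (Fin.castSucc i) ^ 2 = 1) → |z 5 - t₀| ≤ 1 →
        0 ≤ cylKernel p σ z ∧
        ((4 * Real.pi * t) ^ 2)⁻¹ * Real.exp (4 * z 5) *
            Real.exp (-‖(WithLp.toLp 2 (fun i : Fin 5 => Real.exp (z 5) * z (Fin.castSucc i)) :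
              EuclideanSpace ℝ (Fin 5)) - y‖ ^ 2 / (4 * t)) ≤
          Real.exp (4 * ε) * (1 + κ) ^ 2 * (3 / (8 * Real.pi ^ 2)) * cylKernel p σ z +
            c₀ * (3 / (8 * Real.pi ^ 2)) := by
  have hπ := Real.pi_pos
  -- nonnegativity of the typed kernel (from the Cheeger–Yau bound)
  have hKnn : ∀ p : EuclideanSpace ℝ (Fin 6), (∑ i : Fin 5, p (Fin.castSucc i) ^ 2 = 1) → ∀ σ : ℝ, 0 < σ →
      ∀ z : EuclideanSpace ℝ (Fin 6), (∑ i : Fin 5, z (Fin.castSucc i) ^ 2 = 1) → 0 ≤ cylKernel p σ z := by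
    intro p hp σ hσ z hz
    rw [cylKernel_eq]
    have hP := abs_le.1 (abs_sum_mul_le_one hz hp)
    have h := hCY σ hσ _ hP.1 hP.2
    have h0 : 0 < (8 * Real.pi ^ 2 / 3) * ((4 * Real.pi * σ) ^ 2)⁻¹ *
        Real.exp (-(Real.arccos (∑ i : Fin 5, z (Fin.castSucc i) * p (Fin.castSucc i))) ^ 2 /
          (4 * σ)) := by positivity
    exact mul_nonneg (by linarith) (Real.exp_pos _).le
  -- the far threshold `4tΛ ≤ ε² e^{2t₀-2}/4`
  set Λ := Real.log (Real.exp 4 / (6 * c₀)) - 2 * Real.log (t * Real.exp (-2 * t₀)) with hΛ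
  have hthr : 4 * t * Λ ≤ ε ^ 2 * (Real.exp (2 * t₀ - 2) / 4) := by
    have h1 : Real.exp 2 * Real.exp (-2 * t₀) * Real.exp (2 * t₀ - 2) = 1 := by
      rw [← Real.exp_add, ← Real.exp_add, show (2 + -2 * t₀ + (2 * t₀ - 2)) = (0 : ℝ) by ring,
        Real.exp_zero]
    have hid : 4 * t * Λ =
        (16 * Real.exp 2 * (t * Real.exp (-2 * t₀)) * Λ) * (Real.exp (2 * t₀ - 2) / 4) := by
      linear_combination (-(4 * t * Λ)) * h1
    rw [hid]
    exact mul_le_mul_of_nonneg_right hsmall (by positivity)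
  have hε2 : ε ^ 2 ≤ 1 := by nlinarith
  have hsq : Real.exp (2 * t₀ - 2) = Real.exp (t₀ - 1) ^ 2 := by
    rw [← Real.exp_nat_mul]; ring_nf
  by_cases hy : Real.exp (t₀ - 1) / 2 < ‖y‖
  · -- centres at distance comparable with the conformal image of the slab
    have hr : 0 < ‖y‖ := lt_of_le_of_lt (by positivity) hy
    have hy0 : y ≠ 0 := norm_pos_iff.1 hr
    obtain ⟨hp, hpc, hp5⟩ := center_mem hy0
    have hκ1 : 0 < 1 + κ := by linarith
    refine ⟨padL (‖y‖⁻¹ • y) + Real.log ‖y‖ • axis, hp, t * (1 + κ) / ‖y‖ ^ 2, by positivity,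
      fun z hz hzt => ⟨hKnn _ hp _ (by positivity) z hz, ?_⟩⟩
    have hPp : ∑ i : Fin 5, z (Fin.castSucc i) *
        (padL (‖y‖⁻¹ • y) + Real.log ‖y‖ • axis) (Fin.castSucc i) =
          ∑ i : Fin 5, z (Fin.castSucc i) * (‖y‖⁻¹ • y) i :=
      Finset.sum_congr rfl fun i _ => by rw [hpc i]
    have hPabs : |∑ i : Fin 5, z (Fin.castSucc i) * (‖y‖⁻¹ • y) i| ≤ 1 := by
      rw [← hPp]; exact abs_sum_mul_le_one hz hp
    obtain ⟨hP1, hP2⟩ := abs_le.1 hPabs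
    have hD := norm_conf_sub_sq hz hy0
    have hK : cylKernel (padL (‖y‖⁻¹ • y) + Real.log ‖y‖ • axis) (t * (1 + κ) / ‖y‖ ^ 2) z =
        zonal (t * (1 + κ) / ‖y‖ ^ 2) (∑ i : Fin 5, z (Fin.castSucc i) * (‖y‖⁻¹ • y) i) *
          Real.exp (-((z 5 - Real.log ‖y‖) ^ 2) / (4 * (t * (1 + κ) / ‖y‖ ^ 2))) := by
      rw [cylKernel_eq, hPp, hp5]
    by_cases hfar : 4 * t * Λ ≤
        ‖(WithLp.toLp 2 (fun i : Fin 5 => Real.exp (z 5) * z (Fin.castSucc i)) :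
          EuclideanSpace ℝ (Fin 5)) - y‖ ^ 2
    · have hs : z 5 ≤ t₀ + 1 := by linarith [(abs_le.1 hzt).2]
      have h := far_bound ht hc₀ hs hfar
      refine h.trans (le_add_of_nonneg_left ?_)
      exact mul_nonneg (by positivity) (hKnn _ hp _ (by positivity) z hz)
    · push Not at hfar
      have hQε : (Real.exp (z 5) / ‖y‖ - 1) ^ 2 +
          2 * (Real.exp (z 5) / ‖y‖) * (1 - ∑ i : Fin 5, z (Fin.castSucc i) * (‖y‖⁻¹ • y) i) ≤ ε ^ 2 := by
        rw [hD] at hfar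
        have h2 : Real.exp (2 * t₀ - 2) / 4 ≤ ‖y‖ ^ 2 := by
          rw [hsq]; nlinarith [Real.exp_pos (t₀ - 1), hy.le]
        have h3 : ‖y‖ ^ 2 * ((Real.exp (z 5) / ‖y‖ - 1) ^ 2 +
            2 * (Real.exp (z 5) / ‖y‖) * (1 - ∑ i : Fin 5, z (Fin.castSucc i) * (‖y‖⁻¹ • y) i)) ≤
              ‖y‖ ^ 2 * ε ^ 2 := by nlinarith [sq_nonneg ε]
        exact le_of_mul_le_mul_left h3 (by positivity)
      have hZ := hCY (t * (1 + κ) / ‖y‖ ^ 2) (by positivity) _ hP1 hP2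
      have h := near_kernel_bound (s := z 5) hε hε5 hκ hκε ht hr hP1 hP2 hQε hZ
      rw [hD, hK]
      exact h.trans (le_add_of_nonneg_right (by positivity))
  · -- small centres (including `y = 0`): every slab point is far
    push Not at hy
    obtain ⟨p₀, hp₀, -⟩ := exists_center
    refine ⟨p₀, hp₀, 1, one_pos, fun z hz hzt => ⟨hKnn p₀ hp₀ 1 one_pos z hz, ?_⟩⟩
    have hfar : 4 * t * Λ ≤
        ‖(WithLp.toLp 2 (fun i : Fin 5 => Real.exp (z 5) * z (Fin.castSucc i)) :
          EuclideanSpace ℝ (Fin 5)) - y‖ ^ 2 := by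
      have h1 : Real.exp (t₀ - 1) ≤ Real.exp (z 5) :=
        Real.exp_le_exp.2 (by linarith [(abs_le.1 hzt).1])
      have h2 : Real.exp (t₀ - 1) / 2 ≤
          ‖(WithLp.toLp 2 (fun i : Fin 5 => Real.exp (z 5) * z (Fin.castSucc i)) :
            EuclideanSpace ℝ (Fin 5)) - y‖ := by
        have := norm_sub_norm_le
          (WithLp.toLp 2 (fun i : Fin 5 => Real.exp (z 5) * z (Fin.castSucc i)) :
            EuclideanSpace ℝ (Fin 5)) y
        rw [norm_conf hz] at this
        linarith
      nlinarith [hthr, Real.exp_pos (2 * t₀ - 2), Real.exp_pos (t₀ - 1)]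
    have hs : z 5 ≤ t₀ + 1 := by linarith [(abs_le.1 hzt).2]
    have h := far_bound ht hc₀ hs hfar
    refine h.trans (le_add_of_nonneg_left ?_)
    exact mul_nonneg (by positivity) (hKnn p₀ hp₀ 1 one_pos z hz)


/-! ### The domination theorem, modulo the Cheeger–Yau bound -/

/-- **Small-scale conformal domination, conditional on the Cheeger–Yau bound** (the statement of stub
`stub_smallScaleDomination` of line `conformal-kernel-domination`, crux `CylinderEntropy.SliceIsolation` of
route `SmoothPoincare4/CylinderEntropy`, modulo the named fact `CheegerYauZonalSphereFour`): for every
`δ > 0` there is `t₁ > 0` such that for every measurable `A ⊆ N` in a unit slab around height `t₀`, every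
centre `y ∈ ℝ⁵` and every scale `0 < t ≤ t₁ e^{2t₀}`, the Gaussian area of the conformal image satisfies
`F_{y,t}(Φ A) ≤ (1 + δ) λ_cyl(A)`. Proof: layer-cake pushforward `μHE⁴⌊Φ(A) ≤ e^{4h} Φ_#(e^{4s} μHE⁴⌊A)`,
pointwise domination of the pulled-back kernel by `c₁ V⁻¹ K_{p,σ} + c₀ V⁻¹` (`pointwise_domination`),
`V⁻¹ ∫_A K_{p,σ} dμHE⁴ = F̂_{p,σ}(A) ≤ λ_cyl(A)` and `V⁻¹ μHE⁴(A) = μH⁴(A)/μH⁴(S⁴) ≤ λ_cyl(A)`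
(`measure_ratio_le_cylEntropy`), and `e^{4h}(c₁ + c₀) ≤ 1 + δ` (`constants`). [folklore] -/
theorem smallScaleDomination_of_cheegerYau (hCY : CheegerYauZonalSphereFour) :
    ∀ δ : ℝ, 0 < δ → ∃ t₁ : ℝ, 0 < t₁ ∧
      ∀ (t₀ : ℝ) (A : Set (EuclideanSpace ℝ (Fin 6))),
        A ⊆ {z : EuclideanSpace ℝ (Fin 6) | ∑ i : Fin 5, z (Fin.castSucc i) ^ 2 = 1} → MeasurableSet A →
        (∀ z ∈ A, |z 5 - t₀| ≤ 1) →
        ∀ (y : EuclideanSpace ℝ (Fin 5)) (t : ℝ), 0 < t → t ≤ t₁ * Real.exp (2 * t₀) →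
          gaussianArea 4 y t
            ((fun z : EuclideanSpace ℝ (Fin 6) =>
          (WithLp.toLp 2 (fun i : Fin 5 => Real.exp (z 5) * z (Fin.castSucc i)) :
            EuclideanSpace ℝ (Fin 5))) '' A) ≤
            ENNReal.ofReal (1 + δ) * cylEntropy A := by
  intro δ hδ
  -- the constants
  have hδ'0 : 0 < min δ 1 := lt_min hδ one_pos
  have hδ'1 : min δ 1 ≤ 1 := min_le_right _ _
  have hδ'δ : min δ 1 ≤ δ := min_le_left _ _
  obtain ⟨hε5, hκε, htot⟩ := constants hδ'0 hδ'1
  set δ' := min δ 1 with hδ'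
  set ε := δ' / 40 with hε_def
  set κ := 3 * ε with hκ_def
  set c₀ := δ' / 4 with hc₀_def
  have hε : 0 < ε := by positivity
  have hε1 : ε ≤ 1 := by linarith
  have hκ : 0 ≤ κ := by positivity
  have hc₀ : 0 < c₀ := by positivity
  have hπ := Real.pi_pos
  set C := Real.log (Real.exp 4 / (6 * c₀)) with hC_def
  have hC : 0 ≤ C := by
    refine Real.log_nonneg ?_
    rw [le_div_iff₀ (by positivity)]
    have : (4 : ℝ) + 1 ≤ Real.exp 4 := Real.add_one_le_exp 4
    linarith
  refine ⟨(ε ^ 2 / (16 * Real.exp 2 * (C + 4))) ^ 2, by positivity, ?_⟩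
  intro t₀ A hAN hAm hslab y t ht htle
  have hAN' : ∀ z ∈ A, ∑ i : Fin 5, z (Fin.castSucc i) ^ 2 = 1 := fun z hz => hAN hz
  set F : EuclideanSpace ℝ (Fin 6) → EuclideanSpace ℝ (Fin 5) := fun z =>
    (WithLp.toLp 2 (fun i : Fin 5 => Real.exp (z 5) * z (Fin.castSucc i)) :
      EuclideanSpace ℝ (Fin 5)) with hF_def
  have hFm : Measurable F := continuous_conf.measurable
  -- smallness of the normalised scale `T = t e^{-2t₀}`
  have hT0 : 0 < t * Real.exp (-2 * t₀) := by positivity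
  have hTle : t * Real.exp (-2 * t₀) ≤ (ε ^ 2 / (16 * Real.exp 2 * (C + 4))) ^ 2 := by
    rw [show -2 * t₀ = -(2 * t₀) by ring, Real.exp_neg, ← div_eq_mul_inv,
      div_le_iff₀ (Real.exp_pos _)]
    exact htle
  have hsmall : 16 * Real.exp 2 * (t * Real.exp (-2 * t₀)) *
      (Real.log (Real.exp 4 / (6 * c₀)) - 2 * Real.log (t * Real.exp (-2 * t₀))) ≤ ε ^ 2 := by
    have h := smallness hT0 hε hε1 hC hTle
    have h2 : C + 2 * Real.log (1 / (t * Real.exp (-2 * t₀))) =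
        Real.log (Real.exp 4 / (6 * c₀)) - 2 * Real.log (t * Real.exp (-2 * t₀)) := by
      rw [one_div, Real.log_inv, hC_def]; ring
    rw [h2] at h
    exact h
  -- pointwise domination
  obtain ⟨p, hp, σ, hσ, hpt⟩ := pointwise_domination hCY hε hε5 hκ hκε hc₀ ht hsmall y
  -- Step 1: the layer-cake pushforward
  have hL : ∀ (M : ℝ) (S : Set (EuclideanSpace ℝ (Fin 6))), S ⊆ A → (∀ z ∈ S, z 5 ≤ M) →
      μH[4] (F '' S) ≤ ENNReal.ofReal (Real.exp (4 * M)) * μH[4] S :=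
    fun M S hS hM => hausdorffMeasure_image_conf_le M S (fun z hz => hAN' z (hS hz)) hM
  have hh : 0 < Real.log (1 + c₀) / 4 := by
    have : 0 < Real.log (1 + c₀) := Real.log_pos (by linarith)
    positivity
  have he4h : Real.exp (4 * (Real.log (1 + c₀) / 4)) = 1 + c₀ := by
    rw [mul_div_cancel₀ _ four_ne_zero, Real.exp_log (by positivity)]
  have step1 := lintegral_image_le_of_layers_euclidean hAm hFm hL (measurable_gaussianWeight y t) hh
  rw [he4h] at step1
  -- Step 2: pointwise, in `ℝ≥0∞`
  set c₁' := Real.exp (4 * ε) * (1 + κ) ^ 2 * (3 / (8 * Real.pi ^ 2)) with hc₁'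
  set c₀' := c₀ * (3 / (8 * Real.pi ^ 2)) with hc₀'
  have hc₁'0 : 0 ≤ c₁' := by positivity
  have hc₀'0 : 0 ≤ c₀' := by positivity
  have hpt' : ∀ z ∈ A, gaussianNormalization 4 t *
      (ENNReal.ofReal (Real.exp (4 * z 5)) * gaussianWeight y t (F z)) ≤
        ENNReal.ofReal c₀' + ENNReal.ofReal c₁' * ENNReal.ofReal (cylKernel p σ z) := by
    intro z hz
    obtain ⟨hK0, hle⟩ := hpt z (hAN' z hz) (hslab z hz)
    rw [gaussianNormalization_four ht, gaussianWeight, hF_def]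
    rw [← ENNReal.ofReal_mul (Real.exp_pos _).le, ← ENNReal.ofReal_mul (by positivity),
      ← ENNReal.ofReal_mul hc₁'0, ← ENNReal.ofReal_add hc₀'0 (mul_nonneg hc₁'0 hK0)]
    refine ENNReal.ofReal_le_ofReal ?_
    have : ((4 * Real.pi * t) ^ 2)⁻¹ * (Real.exp (4 * z 5) *
        Real.exp (-(‖(WithLp.toLp 2 (fun i : Fin 5 => Real.exp (z 5) * z (Fin.castSucc i)) :
          EuclideanSpace ℝ (Fin 5)) - y‖ ^ 2) / (4 * t))) =
        ((4 * Real.pi * t) ^ 2)⁻¹ * Real.exp (4 * z 5) *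
          Real.exp (-‖(WithLp.toLp 2 (fun i : Fin 5 => Real.exp (z 5) * z (Fin.castSucc i)) :
            EuclideanSpace ℝ (Fin 5)) - y‖ ^ 2 / (4 * t)) := by ring
    rw [this]
    linarith [hle]
  -- Step 3: integrate
  have step2 : ∫⁻ z in A, gaussianNormalization 4 t *
      (ENNReal.ofReal (Real.exp (4 * z 5)) * gaussianWeight y t (F z)) ∂μHE[4] ≤
        ENNReal.ofReal c₀' * μHE[4] A +
          ENNReal.ofReal c₁' * ∫⁻ z in A, ENNReal.ofReal (cylKernel p σ z) ∂μHE[4] := by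
    calc ∫⁻ z in A, gaussianNormalization 4 t *
          (ENNReal.ofReal (Real.exp (4 * z 5)) * gaussianWeight y t (F z)) ∂μHE[4]
        ≤ ∫⁻ z in A, (ENNReal.ofReal c₀' + ENNReal.ofReal c₁' * ENNReal.ofReal (cylKernel p σ z)) ∂μHE[4] :=
          setLIntegral_mono' hAm hpt'
      _ = _ := by
          rw [lintegral_add_left measurable_const, setLIntegral_const,
            lintegral_const_mul' _ _ ENNReal.ofReal_ne_top]
  -- Step 4: from `μHE⁴` to the typed `μH⁴` ratios
  set cH : ℝ≥0∞ := ((Measure.addHaarScalarFactor (volume : Measure (EuclideanSpace ℝ (Fin 4)))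
      (μH[((4 : ℕ) : ℝ)] : Measure (EuclideanSpace ℝ (Fin 4))) : ℝ≥0) : ℝ≥0∞) with hcH_def
  have hcH0 : cH ≠ 0 :=
    ENNReal.coe_ne_zero.2 (Measure.addHaarScalarFactor_volume_hausdorffMeasure_ne_zero 4)
  have hcHtop : cH ≠ ⊤ := ENNReal.coe_ne_top
  have hμA : (μHE[4] : Measure (EuclideanSpace ℝ (Fin 6))) A = cH * μH[4] A := by
    rw [Measure.euclideanHausdorffMeasure_def, Measure.smul_apply, ENNReal.smul_def, smul_eq_mul]
    rfl
  have hIK : ∫⁻ z in A, ENNReal.ofReal (cylKernel p σ z) ∂μHE[4] =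
      cH * ∫⁻ z in A, ENNReal.ofReal (cylKernel p σ z) ∂μH[4] :=
    setLIntegral_euclideanHausdorffMeasure_eq_mul 4 (fun z => ENNReal.ofReal (cylKernel p σ z)) A
  have hS : (μHE[4] : Measure (EuclideanSpace ℝ (Fin 5))) (Metric.sphere (0 : EuclideanSpace ℝ (Fin 5)) 1) =
      cH * μH[4] (Metric.sphere (0 : EuclideanSpace ℝ (Fin 5)) 1) := by
    rw [Measure.euclideanHausdorffMeasure_def, Measure.smul_apply, ENNReal.smul_def, smul_eq_mul]
    rfl
  have hV : ENNReal.ofReal (3 / (8 * Real.pi ^ 2)) =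
      cH⁻¹ * (μH[4] (Metric.sphere (0 : EuclideanSpace ℝ (Fin 5)) 1))⁻¹ := by
    rw [show (3 / (8 * Real.pi ^ 2) : ℝ) = (8 * Real.pi ^ 2 / 3)⁻¹ by field_simp,
      ENNReal.ofReal_inv_of_pos (by positivity), ← euclideanHausdorffMeasure_sphere_four, hS,
      ENNReal.mul_inv (Or.inl hcH0) (Or.inl hcHtop)]
  have hterm0 : ENNReal.ofReal c₀' * (μHE[4] : Measure (EuclideanSpace ℝ (Fin 6))) A =
      ENNReal.ofReal c₀ * ((μH[4] (Metric.sphere (0 : EuclideanSpace ℝ (Fin 5)) 1))⁻¹ * μH[4] A) := by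
    rw [hc₀', ENNReal.ofReal_mul hc₀.le, hV, hμA]
    calc ENNReal.ofReal c₀ * (cH⁻¹ * (μH[4] (Metric.sphere (0 : EuclideanSpace ℝ (Fin 5)) 1))⁻¹) *
          (cH * μH[4] A)
        = ENNReal.ofReal c₀ * (μH[4] (Metric.sphere (0 : EuclideanSpace ℝ (Fin 5)) 1))⁻¹ * (cH⁻¹ * cH) *
            μH[4] A := by ring
      _ = _ := by rw [ENNReal.inv_mul_cancel hcH0 hcHtop]; ring
  have hterm1 : ENNReal.ofReal c₁' * ∫⁻ z in A, ENNReal.ofReal (cylKernel p σ z) ∂μHE[4] =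
      ENNReal.ofReal (Real.exp (4 * ε) * (1 + κ) ^ 2) * cylDensity A p σ := by
    rw [hc₁', ENNReal.ofReal_mul (by positivity), hV, hIK, cylDensity]
    calc ENNReal.ofReal (Real.exp (4 * ε) * (1 + κ) ^ 2) *
          (cH⁻¹ * (μH[4] (Metric.sphere (0 : EuclideanSpace ℝ (Fin 5)) 1))⁻¹) *
            (cH * ∫⁻ z in A, ENNReal.ofReal (cylKernel p σ z) ∂μH[4])
        = ENNReal.ofReal (Real.exp (4 * ε) * (1 + κ) ^ 2) * (cH⁻¹ * cH) *
            ((μH[4] (Metric.sphere (0 : EuclideanSpace ℝ (Fin 5)) 1))⁻¹ *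
              ∫⁻ z in A, ENNReal.ofReal (cylKernel p σ z) ∂μH[4]) := by ring
      _ = _ := by rw [ENNReal.inv_mul_cancel hcH0 hcHtop, mul_one]
  -- Step 5: the two atoms are bounded by the cylinder entropy
  have hB : ∀ z ∈ A, |z 5| ≤ |t₀| + 1 := by
    intro z hz
    have h1 := hslab z hz
    calc |z 5| = |(z 5 - t₀) + t₀| := by ring_nf
      _ ≤ |z 5 - t₀| + |t₀| := abs_add_le _ _
      _ ≤ |t₀| + 1 := by linarith
  have hratio : (μH[4] (Metric.sphere (0 : EuclideanSpace ℝ (Fin 5)) 1))⁻¹ * μH[4] A ≤ cylEntropy A :=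
    measure_ratio_le_cylEntropy hAm hAN' hB
  have hdens : cylDensity A p σ ≤ cylEntropy A :=
    le_iSup_of_le p (le_iSup_of_le hp (le_iSup_of_le σ (le_iSup_of_le hσ le_rfl)))
  have hmass : (1 + c₀) * (c₀ + Real.exp (4 * ε) * (1 + κ) ^ 2) ≤ 1 + δ := by
    have : (1 + c₀) * (Real.exp (4 * ε) * (1 + κ) ^ 2 + c₀) ≤ 1 + δ' := htot
    linarith
  calc gaussianArea 4 y t (F '' A)
      = gaussianNormalization 4 t * ∫⁻ w in F '' A, gaussianWeight y t w ∂μHE[4] := gaussianArea_eq _ _ _ _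
    _ ≤ gaussianNormalization 4 t * (ENNReal.ofReal (1 + c₀) *
          ∫⁻ z in A, ENNReal.ofReal (Real.exp (4 * z 5)) * gaussianWeight y t (F z) ∂μHE[4]) := by
        gcongr
    _ = ENNReal.ofReal (1 + c₀) * ∫⁻ z in A, gaussianNormalization 4 t *
          (ENNReal.ofReal (Real.exp (4 * z 5)) * gaussianWeight y t (F z)) ∂μHE[4] := by
        rw [lintegral_const_mul' (gaussianNormalization 4 t) _ (gaussianNormalization_ne_top 4 t)]
        ring
    _ ≤ ENNReal.ofReal (1 + c₀) * (ENNReal.ofReal c₀' * μHE[4] A +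
          ENNReal.ofReal c₁' * ∫⁻ z in A, ENNReal.ofReal (cylKernel p σ z) ∂μHE[4]) := by
        gcongr
    _ = ENNReal.ofReal (1 + c₀) *
          (ENNReal.ofReal c₀ * ((μH[4] (Metric.sphere (0 : EuclideanSpace ℝ (Fin 5)) 1))⁻¹ * μH[4] A) +
          ENNReal.ofReal (Real.exp (4 * ε) * (1 + κ) ^ 2) * cylDensity A p σ) := by
        rw [hterm0, hterm1]
    _ ≤ ENNReal.ofReal (1 + c₀) * (ENNReal.ofReal c₀ * cylEntropy A +
          ENNReal.ofReal (Real.exp (4 * ε) * (1 + κ) ^ 2) * cylEntropy A) := by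
        gcongr
    _ = ENNReal.ofReal ((1 + c₀) * (c₀ + Real.exp (4 * ε) * (1 + κ) ^ 2)) * cylEntropy A := by
        rw [← add_mul, ← ENNReal.ofReal_add hc₀.le (by positivity), ← mul_assoc,
          ← ENNReal.ofReal_mul (by positivity)]
    _ ≤ ENNReal.ofReal (1 + δ) * cylEntropy A := by
        gcongr


end SphericalCylinderConformal

end Literature.Geometry.Riemannian

end
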